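import Literature.MathematicalPhysics.QuantumFieldTheory.Balaban1983to89.Beta.CouplingMatchingCarrier
import Literature.MathematicalPhysics.QuantumFieldTheory.Balaban1983to89.T4GatedBooking
import Literature.MathematicalPhysics.QuantumFieldTheory.Balaban1983to89.T4BookingNecessity
import Literature.MathematicalPhysics.QuantumFieldTheory.Balaban1983to89.T4SyncThresholds
import Literature.MathematicalPhysics.QuantumFieldTheory.Balaban1983to89.T4UniformRadius

/-!
# The T⁴ consumers of (0.31) under a DEFECTED infrared anchor (audit leaf, T4-DAG v10 row `T4-H3-ANCHOR°`)

The T⁴ cell consumes the two-sided endpoint running (0.31) of [Balaban1987RG1] (Thm 2 p. 259) in the tree's per-step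
normalisation `Step.Discrete031 b β' K g gs` : `1/g² + b(K−k) ≤ 1/g_k² ≤ 1/g² + β'(K−k)` (`k ≤ K`) as the hypothesis
`h031` of the modules `T4SyncThresholds`, `T4MatchingAssembly`, `T4Crossover`, `T4HistoryPeeling`, `T4GoodClassBudget`,
`T4WeightBudget` (+ `T4WeightBudgetKP`), `T4TubeBudget`, `T4PeierlsDomination`, `T4GatedBooking`, `T4BookingNecessity`,
`T4UniformRadius`.  The β sub-cell's slope-carrying END grade delivers (0.31) only in DEFECTED form
(`Beta.CouplingMatchingCarrier.discrete031Defect_of_avgAFH`): the LOWER anchor `1/g²` is replaced by `1/g² − D`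
(`D ≥ 0`, `D·γ² ≤ 1/2` on the coupling box `]0, γ]`, so `1/g² − D ≥ 1/(2g²)`), the upper half is literal, and the pin
`g_K = g` holds by construction.  The defected running is NOT an instance of `Step.Discrete031` for ANY nonnegative lower
slope (`defect_not_literal` below; the tree's parity witness `Beta.CouplingMatchingCarrier.Osc.not_discrete031_even`):
what the defect destroys is exactly the monotonicity `g_k ≤ g` one scale above the pin.

This leaf AUDITS every use of `h031` in the eleven modules for MONOTONICITY IN THE INFRARED ANCHOR and re-derives, in
the kernel, the ROOT lemma of each use from the defected predicate `Defect b β' D K g gs` (§1).  Nothing in the eleven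
modules is modified; node owners keep their files.  Everything here is elementary real arithmetic ([folklore]); the only
citations are the locators the audited lemmas already carry.  RESULT OF THE AUDIT (by name; "root" = the lemma in which
`Step.Discrete031` is actually unfolded; every other use passes `h031` on to a root):

| module | root use of `h031` | half used | where `1/g²` enters | monotone in the anchor | defected form here |
|---|---|---|---|---|---|
| `T4Crossover` | `min_coupling_le` (→ `sum_min_coupling_le`, `summable_sum_min_coupling`, `summable_crossoverDelta`, `cauchySum_of_crossover`) | lower | dropped (`0 ≤ 1/g²`): only `b(K−j) ≤ 1/g_j²` is used | YES, verbatim conclusion, needs only `D ≤ 1/g²` | §3: `…_of_lower` (ANCHOR-FREE hypothesis `b(K−k) ≤ 1/g_k²`, a strict generalisation) and `…_of_defect` |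
| `T4WeightBudget.cauchySum_of_crossover_relWeightBound`, `T4WeightBudgetKP.cauchySum_of_crossover_polymerRep/…polymerDom`, `T4PeierlsDomination.cauchySum_of_crossover_peierlsDom`, `T4HistoryPeeling.cauchySum_of_crossover_slotDom`, `T4MatchingAssembly.hybridNE7_of_slotDom_twoRate_crossover`, `T4GoodClassBudget.summable_budgetDelta` | none (pass-through: `h031` is handed to `T4Crossover.summable_crossoverDelta`, directly or via `T4WeightBudget`) | — | — | YES (inherits from `T4Crossover`; re-keying = substituting `summable_crossoverDelta_of_lower`) | §3 supplies the `Summable (crossoverDelta …)` they manufacture from `h031` |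
| `T4TubeBudget` | `log_inv_sq_le_of_discrete031` (→ `radius_profile_of_discrete031`, `radius_pow_mul_geom_le_of_discrete031`) | upper | as the constant `(1/g² + β')` | YES, verbatim (upper half is literal; pin `g_K = g`) | §2/§4: via the literal surrogate `Step.Discrete031 (−D) β' K g gs` |
| `T4UniformRadius` | `oscExponentBound_of_discrete031` (via `T4TubeBudget`) | upper | `Γ = (D_R(1/g²+β')^r)⁴ C_{4r}(θ)` | YES, verbatim | §4 |
| `T4GatedBooking` | `sq_le_inv_of_discrete031`, `pow_coupling_le_of_discrete031` (→ `weight_le_profile_of_discrete031`, `sum_weights_le_of_discrete031`, `tubeBudget_uniform_of_discrete031`, and the sharp `…_sharp` family) | lower (couplings) + upper (radii, crude family only) | coupling constant `min(1/g², b)`; radius constant `(1/g² + β')` | YES with `min(1/g², b) ↦ min(1/(2g²), b)` (radius constant unchanged) | §5 |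
| `T4BookingNecessity` | `one_le_inv_sq` (lower + `g ≤ 1` ⇒ `1 ≤ 1/g_j²`), `inv_sq_le_logWindow` (upper) (→ `eventually_inv_sq_le_mul_log` → the `eventually_rpow_neg_le_…` family) | both | `1 ≤ 1/g²`; constant `(1/g² + β'(C+1))` | YES with the smallness clause `g ≤ 1 ↦ 2g² ≤ 1` (upper: verbatim) | §6 |
| `T4SyncThresholds` | `sync_sq_ratio` (via `sq_cross_bound`; → `sync_log_le`, `sync_profile_le`, `sync_eps_sq_le`, `sync_R_le`) | both (two-sided comparability with the reference `RefSandwich`) | `a = 1/g² ≥ 0` in `sq_cross_bound` | YES with the comparability constant `c₀² = β'/b ↦ β'/b + 1` in the direction run ↦ reference (the other direction verbatim) | §7 |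

USES THAT NEED THE LITERAL ANCHOR: none found.  No audited lemma uses `g_k ≤ g` (the only consequence of the literal lower
half that the defect destroys, `defect_not_literal`); every use is either of the upper half (literal), or of the lower half
as AF-decay `1/g_k² ≥ c + b(K−k)` with a constant `c` that may be halved, or of `1/g_k² ≥ 1` (a smallness clause on the
renormalised coupling).  Out of scope: the β/B14-side modules that PRODUCE or TRANSFER (0.31) (`Step`, `FlowStep`,
`FlowStepRuns`, `B12*`, `B14FlowStep`, `DagBinding`, `Beta/*`); `B14FlowStep.flowControl_of_avgAF` is already keyed to the
averaged-AF grade directly.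
-/

namespace Literature.MathematicalPhysics.QuantumFieldTheory.Balaban1983to89.T4Discrete031Defect

open Finset Filter Topology
open Literature.MathematicalPhysics.QuantumFieldTheory.Balaban1983to89
open Literature.MathematicalPhysics.QuantumFieldTheory.Balaban1983to89.T4GatedBooking
  (weightProfile weightProfile_nonneg summable_weightProfile sqrtProfile sqrtProfile_nonneg summable_sqrtProfile
    min_mul_succ_le succ_pow_div_pow_le mul_pow_log_inv_sq_le)
open Literature.MathematicalPhysics.QuantumFieldTheory.Balaban1983to89.T4Crossover (crossoverDelta)

/-! ## §1 The defected running and its elementary consequences -/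

/-- **THE DEFECTED TWO-SIDED RUNNING** (the shape delivered by `Beta.CouplingMatchingCarrier.discrete031Defect_of_avgAFH`):
`1/g² − D + b(K−k) ≤ 1/g_k² ≤ 1/g² + β'(K−k)` for `k ≤ K` — `Step.Discrete031 b β' K g gs` with the infrared anchor of the
LOWER half lowered by the defect `D`; `D = 0` is the literal (0.31). [cite: Balaban1987RG1, (0.31) p.259] -/
def Defect (b β' D : ℝ) (K : ℕ) (g : ℝ) (gs : ℕ → ℝ) : Prop :=
  ∀ k, k ≤ K → 1 / g ^ 2 - D + b * ((K : ℝ) - k) ≤ 1 / (gs k) ^ 2 ∧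
    1 / (gs k) ^ 2 ≤ 1 / g ^ 2 + β' * ((K : ℝ) - k)

/-- The literal (0.31) is the defect-free case. [folklore] -/
theorem defect_of_discrete031 {b β' g : ℝ} {K : ℕ} {gs : ℕ → ℝ} (h : Step.Discrete031 b β' K g gs) :
    Defect b β' 0 K g gs := fun k hk => ⟨by have := (h k hk).1; linarith, (h k hk).2⟩

/-- Monotonicity in the defect. [folklore] -/
theorem Defect.mono {b β' D D' g : ℝ} {K : ℕ} {gs : ℕ → ℝ} (h : Defect b β' D K g gs) (hDD' : D ≤ D') :
    Defect b β' D' K g gs := fun k hk => ⟨by have := (h k hk).1; linarith, (h k hk).2⟩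

/-- Monotonicity in the slopes: a smaller lower slope and a larger upper slope are still admissible. [folklore] -/
theorem Defect.slope_mono {b b₁ β' β₁ D g : ℝ} {K : ℕ} {gs : ℕ → ℝ} (h : Defect b β' D K g gs) (hb : b₁ ≤ b)
    (hβ : β' ≤ β₁) : Defect b₁ β₁ D K g gs := by
  intro k hk
  have hKk : 0 ≤ (K : ℝ) - k := sub_nonneg.2 (by exact_mod_cast hk)
  obtain ⟨h1, h2⟩ := h k hk
  exact ⟨by nlinarith [mul_le_mul_of_nonneg_right hb hKk], by nlinarith [mul_le_mul_of_nonneg_right hβ hKk]⟩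

/-- The upper half is literal. [folklore] -/
theorem Defect.upper {b β' D g : ℝ} {K : ℕ} {gs : ℕ → ℝ} (h : Defect b β' D K g gs) {k : ℕ} (hk : k ≤ K) :
    1 / (gs k) ^ 2 ≤ 1 / g ^ 2 + β' * ((K : ℝ) - k) := (h k hk).2

/-- The lower half without the anchor: `b(K−k) ≤ 1/g_k²` as soon as `D ≤ 1/g²`. [folklore] -/
theorem Defect.lower_noAnchor {b β' D g : ℝ} {K : ℕ} {gs : ℕ → ℝ} (h : Defect b β' D K g gs) (hD : D ≤ 1 / g ^ 2)
    {k : ℕ} (hk : k ≤ K) : b * ((K : ℝ) - k) ≤ 1 / (gs k) ^ 2 := by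
  have := (h k hk).1
  linarith

/-- The lower half with the HALVED anchor: `1/(2g²) + b(K−k) ≤ 1/g_k²` as soon as `D ≤ 1/(2g²)`. [folklore] -/
theorem Defect.lower_halfAnchor {b β' D g : ℝ} {K : ℕ} {gs : ℕ → ℝ} (h : Defect b β' D K g gs)
    (hD : D ≤ 1 / (2 * g ^ 2)) {k : ℕ} (hk : k ≤ K) : 1 / (2 * g ^ 2) + b * ((K : ℝ) - k) ≤ 1 / (gs k) ^ 2 := by
  have h1 := (h k hk).1
  have e : (1 : ℝ) / (2 * g ^ 2) = 1 / g ^ 2 / 2 := by ring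
  rw [e] at hD ⊢
  linarith

/-- The box form of the defect smallness: `D ≥ 0`, `g_K ≤ γ` and `D·γ² ≤ 1/2` give `D ≤ 1/(2 g_K²)` — the carrier's side
condition (`Beta.AveragedAFCarrier`, `hDγ'`) in the form used below. [folklore] -/
theorem halfAnchor_of_box {D γ x : ℝ} (hD : 0 ≤ D) (hx : 0 < x) (hxγ : x ≤ γ) (hDγ : D * γ ^ 2 ≤ 1 / 2) :
    D ≤ 1 / (2 * x ^ 2) := by
  have hx2 : 0 < x ^ 2 := pow_pos hx 2
  have h1 : D * x ^ 2 ≤ D * γ ^ 2 := mul_le_mul_of_nonneg_left (pow_le_pow_left₀ hx.le hxγ 2) hD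
  rw [le_div_iff₀ (by positivity)]
  linarith

/-- The pin slack from above: `g ≤ g_K` (upper half at `k = K`). [folklore] -/
theorem Defect.anchor_le {b β' D g : ℝ} {K : ℕ} {gs : ℕ → ℝ} (h : Defect b β' D K g gs) (hg : 0 < g)
    (hK : 0 < gs K) : g ≤ gs K := by
  have h2 : 1 / (gs K) ^ 2 ≤ 1 / g ^ 2 := by simpa using (h K le_rfl).2
  have h3 : g ^ 2 ≤ (gs K) ^ 2 := (one_div_le_one_div (pow_pos hK 2) (pow_pos hg 2)).mp h2
  nlinarith

/-- The pin slack from below: `g_K² ≤ 2g²` (lower half at `k = K`, `D ≤ 1/(2g²)`). [folklore] -/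
theorem Defect.sq_anchor_le {b β' D g : ℝ} {K : ℕ} {gs : ℕ → ℝ} (h : Defect b β' D K g gs) (hg : 0 < g)
    (hK : 0 < gs K) (hD : D ≤ 1 / (2 * g ^ 2)) : (gs K) ^ 2 ≤ 2 * g ^ 2 := by
  have h1 : 1 / (2 * g ^ 2) ≤ 1 / (gs K) ^ 2 := by simpa using h.lower_halfAnchor hD le_rfl
  exact (one_div_le_one_div (by positivity) (pow_pos hK 2)).mp h1

/-- **THE CARRIER'S OUTPUT IS A `Defect`** (bridge to `Beta.CouplingMatchingCarrier.discrete031Defect_of_avgAFH`): along a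
solution of (0.20) with couplings in `]0, γ]` up to `K`, the averaged-AF grade `BetaAvgAFH s D γ β` and the upper bound
`BetaUpperH β' γ β` give `Defect s β' D K (g_K) gs` — anchored at the run's own final coupling, so the pin is `rfl`.
[cite: Balaban1987RG1, (0.31) p.259 and §1 p.264] -/
theorem defect_of_avgAFH {β : FlowStep.HBeta} {γ s D β' : ℝ} {K : ℕ} {gs : ℕ → ℝ} (h : FlowStep.RGEqH K β gs)
    (hbox : ∀ i, i ≤ K → 0 < gs i ∧ gs i ≤ γ) (hav : Beta.AveragedAFCarrier.BetaAvgAFH s D γ β)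
    (hup : FlowStep.BetaUpperH β' γ β) : Defect s β' D K (gs K) gs := by
  intro k hk
  obtain ⟨h1, h2⟩ := Beta.CouplingMatchingCarrier.discrete031Defect_of_avgAFH h hbox hav hup k hk
  exact ⟨by linarith, h2⟩

/-- **THE DEFECT IS NOT AN ARTEFACT: a defected running that is NOT literal for ANY nonnegative lower slope.**  Two steps
(`K = 1`), pinned at `g_1 = g = 1`, with `g_0 = 5/4 > g_1` (the coupling one scale above the pin EXCEEDS the pinned value —
the oscillation of `Beta.CouplingMatchingCarrier.Osc`): `Defect (1/10) 1 (1/2) 1 1 gs` holds (and `D = 1/2 = 1/(2g²)`), but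
`Step.Discrete031 b₀ β₀ 1 1 gs` fails for every `b₀ ≥ 0` and every `β₀`.  So no consumer can be served by re-instantiating
its literal `h031`; each use has to be (and below is) audited. [folklore] -/
theorem defect_not_literal : ∃ gs : ℕ → ℝ, Defect (1 / 10) 1 (1 / 2) 1 1 gs ∧ gs 1 = 1 ∧
    (∀ k, k ≤ 1 → 0 < gs k) ∧ ∀ b₀ β₀ : ℝ, 0 ≤ b₀ → ¬ Step.Discrete031 b₀ β₀ 1 1 gs := by
  refine ⟨fun k => if k = 0 then 5 / 4 else 1, ?_, by simp, ?_, ?_⟩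
  · intro k hk
    interval_cases k <;> norm_num
  · intro k hk
    interval_cases k <;> norm_num
  · intro b₀ β₀ hb₀ h
    have h0 := (h 0 (by norm_num)).1
    norm_num at h0
    linarith

/-! ## §2 The literal surrogate for UPPER-half consumers

With the pin `g_K = g`, the defected running IS a literal `Step.Discrete031` — with the NEGATIVE lower slope `−D`.  Every
audited lemma that uses only the upper half carries no sign hypothesis on `b`, so it applies verbatim to this surrogate. -/

/-- `Defect b β' D K g gs` with `b, D ≥ 0` and the pin `g_K = g` gives `Step.Discrete031 (−D) β' K g gs`. [folklore] -/
theorem discrete031_negSlope_of_defect {b β' D g : ℝ} {K : ℕ} {gs : ℕ → ℝ} (h : Defect b β' D K g gs)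
    (hb : 0 ≤ b) (hD : 0 ≤ D) (hpin : gs K = g) : Step.Discrete031 (-D) β' K g gs := by
  intro k hk
  refine ⟨?_, (h k hk).2⟩
  rcases Nat.lt_or_ge k K with hlt | hge
  · have h1 := (h k hk).1
    have hKk : (1 : ℝ) ≤ (K : ℝ) - k := by
      have : (k : ℝ) + 1 ≤ K := by exact_mod_cast Nat.succ_le_of_lt hlt
      linarith
    have hbt : 0 ≤ b * ((K : ℝ) - k) := mul_nonneg hb (by linarith)
    have hDt : D ≤ D * ((K : ℝ) - k) := le_mul_of_one_le_right hD hKk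
    linarith
  · have hkK : k = K := le_antisymm hk hge
    subst hkK
    simp [hpin]

/-! ## §3 `T4Crossover` (and its six pass-through consumers): the anchor is never used

`T4Crossover.min_coupling_le` uses the lower half only through `b(K−j) ≤ 1/g_j²` (it discards `1/g² ≥ 0`).  The versions
below take exactly that ANCHOR-FREE hypothesis; the tree's statements and the defected ones are both instances. -/

/-- The anchor-free lower running from the literal (0.31). [folklore] -/
theorem lower_noAnchor_of_discrete031 {b β' g : ℝ} {K : ℕ} {gs : ℕ → ℝ} (h : Step.Discrete031 b β' K g gs) {k : ℕ}
    (hk : k ≤ K) : b * ((K : ℝ) - k) ≤ 1 / (gs k) ^ 2 := by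
  have h1 := (h k hk).1
  have h2 : 0 ≤ 1 / g ^ 2 := by positivity
  linarith

/-- **Crossover lemma (ii), one term, ANCHOR-FREE** (cf. `T4Crossover.min_coupling_le`): under `b(K−k) ≤ 1/g_k²` (`b > 0`),
nonnegative couplings, `R₁, C ≥ 0`, `0 < θ ≤ Λ`, `σ > 0`, `j + n = K`:
`min(R₁ g_j^{κ₀}, C θ^j Λ^n) ≤ R₁ (b σ (K+1))^{−κ₀/2} + C (Λ/θ)^σ (θ (Λ/θ)^σ)^K`. [folklore] -/
theorem min_coupling_le_of_lower {b R₁ C θ Λ σ : ℝ} {K : ℕ} {gs : ℕ → ℝ} {κ₀ : ℕ} (hb : 0 < b)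
    (hlow : ∀ k, k ≤ K → b * ((K : ℝ) - k) ≤ 1 / (gs k) ^ 2) (hpos : ∀ k, k ≤ K → 0 ≤ gs k) (hR₁ : 0 ≤ R₁)
    (hC : 0 ≤ C) (hθ : 0 < θ) (hθΛ : θ ≤ Λ) (hσ : 0 < σ) {j n : ℕ} (h : j + n = K) :
    min (R₁ * gs j ^ κ₀) (C * θ ^ j * Λ ^ n)
      ≤ R₁ * (b * σ * ((K : ℝ) + 1))⁻¹ ^ ((κ₀ : ℝ) / 2) + C * (Λ / θ) ^ σ * (θ * (Λ / θ) ^ σ) ^ K := by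
  have hr0 : 0 < Λ / θ := div_pos (hθ.trans_le hθΛ) hθ
  have hold0 : 0 ≤ R₁ * (b * σ * ((K : ℝ) + 1))⁻¹ ^ ((κ₀ : ℝ) / 2) :=
    mul_nonneg hR₁ (Real.rpow_nonneg (inv_nonneg.mpr (by positivity)) _)
  have hrec0 : 0 ≤ C * (Λ / θ) ^ σ * (θ * (Λ / θ) ^ σ) ^ K :=
    mul_nonneg (mul_nonneg hC (Real.rpow_nonneg hr0.le _))
      (pow_nonneg (mul_nonneg hθ.le (Real.rpow_nonneg hr0.le _)) K)
  have hj : j ≤ K := by omega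
  by_cases hn : σ * ((K : ℝ) + 1) ≤ (n : ℝ)
  · have hD : 0 < b * σ * ((K : ℝ) + 1) := by positivity
    have hKj : (K : ℝ) - j = n := by
      have : (K : ℝ) = j + n := by rw [← h]; push_cast; ring
      linarith
    have hle : b * σ * ((K : ℝ) + 1) ≤ 1 / gs j ^ 2 := by
      have h1 := hlow j hj
      rw [hKj] at h1
      nlinarith
    exact (T4Crossover.min_le_of_inv_sq_le hR₁ (hpos j hj) hD hle _).trans (le_add_of_nonneg_right hrec0)
  · exact (T4Crossover.min_le_of_remaining_le hC hθ hθΛ h (not_le.mp hn).le _).trans (le_add_of_nonneg_left hold0)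

/-- **Crossover lemma (ii), the sum, ANCHOR-FREE** (cf. `T4Crossover.sum_min_coupling_le`). [folklore] -/
theorem sum_min_coupling_le_of_lower {b R₁ C θ Λ σ : ℝ} {K : ℕ} {gs : ℕ → ℝ} {κ₀ : ℕ} (hb : 0 < b)
    (hlow : ∀ k, k ≤ K → b * ((K : ℝ) - k) ≤ 1 / (gs k) ^ 2) (hpos : ∀ k, k ≤ K → 0 ≤ gs k) (hR₁ : 0 ≤ R₁)
    (hC : 0 ≤ C) (hθ : 0 < θ) (hθΛ : θ ≤ Λ) (hσ : 0 < σ) :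
    ∑ p ∈ antidiagonal K, min (R₁ * gs p.1 ^ κ₀) (C * θ ^ p.1 * Λ ^ p.2)
      ≤ ((K : ℝ) + 1) *
        (R₁ * (b * σ * ((K : ℝ) + 1))⁻¹ ^ ((κ₀ : ℝ) / 2) + C * (Λ / θ) ^ σ * (θ * (Λ / θ) ^ σ) ^ K) := by
  calc ∑ p ∈ antidiagonal K, min (R₁ * gs p.1 ^ κ₀) (C * θ ^ p.1 * Λ ^ p.2)
      ≤ ∑ p ∈ antidiagonal K,
          (R₁ * (b * σ * ((K : ℝ) + 1))⁻¹ ^ ((κ₀ : ℝ) / 2) + C * (Λ / θ) ^ σ * (θ * (Λ / θ) ^ σ) ^ K) :=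
        Finset.sum_le_sum fun p hp => min_coupling_le_of_lower hb hlow hpos hR₁ hC hθ hθΛ hσ (mem_antidiagonal.mp hp)
    _ = _ := by
        rw [Finset.sum_const, Finset.Nat.card_antidiagonal, nsmul_eq_mul]
        push_cast
        ring

/-- **Summability of crossover sum (ii) over `K`, ANCHOR-FREE** (cf. `T4Crossover.summable_sum_min_coupling`): for runs
indexed by `K` with `b(K−k) ≤ 1/(g K k)²`, `κ₀ > 4` and a contracting recent-scale rate. [folklore] -/
theorem summable_sum_min_coupling_of_lower {b R₁ C θ Λ σ : ℝ} {gs : ℕ → ℕ → ℝ} {κ₀ : ℕ} (hb : 0 < b)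
    (hlow : ∀ K k : ℕ, k ≤ K → b * ((K : ℝ) - k) ≤ 1 / (gs K k) ^ 2) (hpos : ∀ K k, k ≤ K → 0 ≤ gs K k)
    (hR₁ : 0 ≤ R₁) (hC : 0 ≤ C) (hθ : 0 < θ) (hθΛ : θ ≤ Λ) (hσ : 0 < σ) (hq : θ * (Λ / θ) ^ σ < 1)
    (hκ : 4 < κ₀) :
    Summable (fun K : ℕ => ∑ p ∈ antidiagonal K, min (R₁ * gs K p.1 ^ κ₀) (C * θ ^ p.1 * Λ ^ p.2)) := by
  have hr0 : 0 < Λ / θ := div_pos (hθ.trans_le hθΛ) hθ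
  have hq0 : 0 ≤ θ * (Λ / θ) ^ σ := mul_nonneg hθ.le (Real.rpow_nonneg hr0.le _)
  have hκ' : (2 : ℝ) < (κ₀ : ℝ) / 2 := by
    have : (4 : ℝ) < κ₀ := by exact_mod_cast hκ
    linarith
  have hA := (T4Crossover.summable_succ_mul_inv_rpow (mul_pos hb hσ) hκ').mul_left R₁
  have hB := (T4CauchySum.summable_succ_pow_mul_geometric hq0 hq 1).mul_left (C * (Λ / θ) ^ σ)
  have hbound : Summable (fun K : ℕ => ((K : ℝ) + 1) *
      (R₁ * (b * σ * ((K : ℝ) + 1))⁻¹ ^ ((κ₀ : ℝ) / 2) + C * (Λ / θ) ^ σ * (θ * (Λ / θ) ^ σ) ^ K)) := by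
    refine (hA.add hB).congr fun K => ?_
    simp only [pow_one]
    ring
  refine Summable.of_nonneg_of_le (fun K => Finset.sum_nonneg fun p hp => ?_) (fun K => ?_) hbound
  · have hj : p.1 ≤ K := by have := mem_antidiagonal.mp hp; omega
    exact le_min (mul_nonneg hR₁ (pow_nonneg (hpos K p.1 hj) _))
      (mul_nonneg (mul_nonneg hC (pow_nonneg hθ.le _)) (pow_nonneg (hθ.le.trans hθΛ) _))
  · exact sum_min_coupling_le_of_lower hb (hlow K) (hpos K) hR₁ hC hθ hθΛ hσ

/-- **`Summable δ`, ANCHOR-FREE** (cf. `T4Crossover.summable_crossoverDelta` — the one theorem through which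
`T4WeightBudget`, `T4WeightBudgetKP`, `T4PeierlsDomination`, `T4HistoryPeeling`, `T4MatchingAssembly` and
`T4GoodClassBudget` consume `h031`): for `0 < a < 1`, `0 < θ < 1`, `θ ≤ Λ`, `b(K−k) ≤ 1/(g K k)²` (`b > 0`), nonnegative
couplings, `R₁, C ≥ 0`, `κ₀ > 4` and a summable `w`, the crossover majorant is summable. [folklore] -/
theorem summable_crossoverDelta_of_lower {E a θ Λ b R₁ C : ℝ} {κ₀ : ℕ} {gs : ℕ → ℕ → ℝ} {w : ℕ → ℝ}
    (ha0 : 0 < a) (ha1 : a < 1) (hθ : 0 < θ) (hθ1 : θ < 1) (hθΛ : θ ≤ Λ) (hb : 0 < b)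
    (hlow : ∀ K k : ℕ, k ≤ K → b * ((K : ℝ) - k) ≤ 1 / (gs K k) ^ 2) (hpos : ∀ K k, k ≤ K → 0 ≤ gs K k)
    (hR₁ : 0 ≤ R₁) (hC : 0 ≤ C) (hκ : 4 < κ₀) (hw : Summable w) :
    Summable (crossoverDelta E a θ Λ R₁ C κ₀ gs w) := by
  obtain ⟨σ, hσ, hq⟩ := T4Crossover.exists_recentRate_lt_one hθ hθ1 hθΛ
  exact (((T4Crossover.summable_sum_min_pow ha0 ha1 hθ hθ1 hθΛ).mul_left E).add
    (summable_sum_min_coupling_of_lower hb hlow hpos hR₁ hC hθ hθΛ hσ hq hκ)).add hw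

/-- **Node U6 from U4′ + U5, ANCHOR-FREE** (cf. `T4Crossover.cauchySum_of_crossover`). [folklore] -/
theorem cauchySum_of_crossover_of_lower {E a θ Λ b R₁ C vol l₀ : ℝ} {κ₀ : ℕ} {gs : ℕ → ℕ → ℝ} {w : ℕ → ℝ}
    {Z : ℕ → ℝ → ℝ} (ha0 : 0 < a) (ha1 : a < 1) (hθ : 0 < θ) (hθ1 : θ < 1) (hθΛ : θ ≤ Λ) (hb : 0 < b)
    (hlow : ∀ K k : ℕ, k ≤ K → b * ((K : ℝ) - k) ≤ 1 / (gs K k) ^ 2) (hpos : ∀ K k, k ≤ K → 0 ≤ gs K k)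
    (hR₁ : 0 ≤ R₁) (hC : 0 ≤ C) (hκ : 4 < κ₀) (hw : Summable w) (hl₀ : 0 ≤ l₀)
    (hU5 : T4CauchySum.MatchingModConstants vol l₀ (crossoverDelta E a θ Λ R₁ C κ₀ gs w) Z) :
    Summable (crossoverDelta E a θ Λ R₁ C κ₀ gs w) ∧
    (∀ t : ℝ, |t| ≤ l₀ → CauchySeq fun K => T4CauchySum.genFun Z K t) ∧
    TendstoUniformlyOn (fun K t => T4CauchySum.genFun Z K t) (T4CauchySum.genFunLim Z) Filter.atTop
      {t | |t| ≤ l₀} := by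
  have hδ := summable_crossoverDelta_of_lower (E := E) (Λ := Λ) (R₁ := R₁) (C := C) (w := w)
    ha0 ha1 hθ hθ1 hθΛ hb hlow hpos hR₁ hC hκ hw
  exact ⟨hδ, fun t ht => T4CauchySum.cauchySeq_genFun hU5 hl₀ hδ ht,
    T4CauchySum.tendstoUniformlyOn_genFun hU5 hl₀ hδ⟩

/-- The anchor-free lower running of a `K`-indexed family from the defected running (`D_K ≤ 1/g_K²`; with the carrier's
`D·γ² ≤ 1/2` one even has `D ≤ 1/(2g²)`). [folklore] -/
theorem lower_noAnchor_of_defect_family {b β' : ℝ} {D g : ℕ → ℝ} {gs : ℕ → ℕ → ℝ}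
    (hdef : ∀ K, Defect b β' (D K) K (g K) (gs K)) (hD1 : ∀ K, D K ≤ 1 / (g K) ^ 2) :
    ∀ K k : ℕ, k ≤ K → b * ((K : ℝ) - k) ≤ 1 / (gs K k) ^ 2 := fun K _ hk => (hdef K).lower_noAnchor (hD1 K) hk

/-- **`Summable δ` UNDER THE DEFECTED RUNNING** — `T4Crossover.summable_crossoverDelta` with `h031` replaced by
`Defect b β' D_K K g_K (gs K)`, `D_K ≤ 1/g_K²`; the conclusion and every constant verbatim. [folklore] -/
theorem summable_crossoverDelta_of_defect {E a θ Λ b β' R₁ C : ℝ} {κ₀ : ℕ} {D g : ℕ → ℝ} {gs : ℕ → ℕ → ℝ}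
    {w : ℕ → ℝ} (ha0 : 0 < a) (ha1 : a < 1) (hθ : 0 < θ) (hθ1 : θ < 1) (hθΛ : θ ≤ Λ) (hb : 0 < b)
    (hdef : ∀ K, Defect b β' (D K) K (g K) (gs K)) (hD1 : ∀ K, D K ≤ 1 / (g K) ^ 2)
    (hpos : ∀ K k, k ≤ K → 0 ≤ gs K k) (hR₁ : 0 ≤ R₁) (hC : 0 ≤ C) (hκ : 4 < κ₀) (hw : Summable w) :
    Summable (crossoverDelta E a θ Λ R₁ C κ₀ gs w) :=
  summable_crossoverDelta_of_lower ha0 ha1 hθ hθ1 hθΛ hb (lower_noAnchor_of_defect_family hdef hD1) hpos hR₁ hC hκ hw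

/-- **Node U6 UNDER THE DEFECTED RUNNING** — `T4Crossover.cauchySum_of_crossover` re-keyed. [folklore] -/
theorem cauchySum_of_crossover_of_defect {E a θ Λ b β' R₁ C vol l₀ : ℝ} {κ₀ : ℕ} {D g : ℕ → ℝ}
    {gs : ℕ → ℕ → ℝ} {w : ℕ → ℝ} {Z : ℕ → ℝ → ℝ} (ha0 : 0 < a) (ha1 : a < 1) (hθ : 0 < θ) (hθ1 : θ < 1)
    (hθΛ : θ ≤ Λ) (hb : 0 < b) (hdef : ∀ K, Defect b β' (D K) K (g K) (gs K)) (hD1 : ∀ K, D K ≤ 1 / (g K) ^ 2)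
    (hpos : ∀ K k, k ≤ K → 0 ≤ gs K k) (hR₁ : 0 ≤ R₁) (hC : 0 ≤ C) (hκ : 4 < κ₀) (hw : Summable w)
    (hl₀ : 0 ≤ l₀) (hU5 : T4CauchySum.MatchingModConstants vol l₀ (crossoverDelta E a θ Λ R₁ C κ₀ gs w) Z) :
    Summable (crossoverDelta E a θ Λ R₁ C κ₀ gs w) ∧
    (∀ t : ℝ, |t| ≤ l₀ → CauchySeq fun K => T4CauchySum.genFun Z K t) ∧
    TendstoUniformlyOn (fun K t => T4CauchySum.genFun Z K t) (T4CauchySum.genFunLim Z) Filter.atTop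
      {t | |t| ≤ l₀} :=
  cauchySum_of_crossover_of_lower ha0 ha1 hθ hθ1 hθΛ hb (lower_noAnchor_of_defect_family hdef hD1) hpos hR₁ hC hκ hw
    hl₀ hU5

/-! ## §4 `T4TubeBudget`, `T4UniformRadius`: upper half only — verbatim through the surrogate of §2 -/

/-- `T4TubeBudget.log_inv_sq_le_of_discrete031` under the defected running: verbatim. [cite: Balaban1987RG1, (0.31) p.259] -/
theorem log_inv_sq_le_of_defect {b β' D g : ℝ} {K : ℕ} {gs : ℕ → ℝ} (h : Defect b β' D K g gs) (hb : 0 ≤ b)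
    (hD : 0 ≤ D) (hpin : gs K = g) (hβ' : 0 ≤ β') {j : ℕ} (hj : j ≤ K) (hgs : 0 < gs j) :
    Real.log ((gs j) ^ 2)⁻¹ ≤ (1 / g ^ 2 + β') * ((((K - j : ℕ) : ℝ)) + 1) :=
  T4TubeBudget.log_inv_sq_le_of_discrete031 (discrete031_negSlope_of_defect h hb hD hpin) hβ' hj hgs

/-- `T4TubeBudget.radius_profile_of_discrete031` under the defected running: verbatim (radius amplitude `Dr`).
[cite: Balaban1988Convergent, (2.5) p.255] -/
theorem radius_profile_of_defect {b β' D g Dr : ℝ} {K r : ℕ} {gs R : ℕ → ℝ} (h : Defect b β' D K g gs)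
    (hb : 0 ≤ b) (hD : 0 ≤ D) (hpin : gs K = g) (hβ' : 0 ≤ β') (hDr : 0 ≤ Dr) (hgs0 : ∀ j ≤ K, 0 < gs j)
    (hgs1 : ∀ j ≤ K, gs j ≤ 1) (hR : ∀ j ≤ K, R j ≤ Dr * (Real.log ((gs j) ^ 2)⁻¹) ^ r) {j : ℕ} (hj : j ≤ K) :
    R j ≤ Dr * (1 / g ^ 2 + β') ^ r * ((((K - j : ℕ) : ℝ)) + 1) ^ r :=
  T4TubeBudget.radius_profile_of_discrete031 (discrete031_negSlope_of_defect h hb hD hpin) hβ' hDr hgs0 hgs1 hR hj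

/-- `T4TubeBudget.radius_pow_mul_geom_le_of_discrete031` under the defected running: verbatim. [folklore] -/
theorem radius_pow_mul_geom_le_of_defect {b β' D g Dr θ : ℝ} {K r : ℕ} {gs R : ℕ → ℝ} (h : Defect b β' D K g gs)
    (hb : 0 ≤ b) (hD : 0 ≤ D) (hpin : gs K = g) (hβ' : 0 ≤ β') (hDr : 0 ≤ Dr) (hθ0 : 0 ≤ θ) (hθ1 : θ < 1)
    (hgs0 : ∀ j ≤ K, 0 < gs j) (hgs1 : ∀ j ≤ K, gs j ≤ 1) (hR0 : ∀ j ≤ K, 0 ≤ R j)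
    (hR : ∀ j ≤ K, R j ≤ Dr * (Real.log ((gs j) ^ 2)⁻¹) ^ r) {j : ℕ} (hj : j ≤ K) :
    R j ^ 4 * θ ^ (K - j) ≤ (Dr * (1 / g ^ 2 + β') ^ r) ^ 4 * T4TubeBudget.geomPolyConst (4 * r) θ :=
  T4TubeBudget.radius_pow_mul_geom_le_of_discrete031 (discrete031_negSlope_of_defect h hb hD hpin) hβ' hDr hθ0 hθ1
    hgs0 hgs1 hR0 hR hj

/-- `T4UniformRadius.oscExponentBound_of_discrete031` under the defected running: verbatim (`Γ` a function of the final
coupling only). [folklore] -/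
theorem oscExponentBound_of_defect {b β' D g Dr θ C_W ℓ B t c : ℝ} {K r : ℕ} {gs R : ℕ → ℝ} {N : ℕ → ℕ}
    (h : Defect b β' D K g gs) (hb : 0 ≤ b) (hD : 0 ≤ D) (hpin : gs K = g) (hβ' : 0 ≤ β') (hDr : 0 ≤ Dr)
    (hθ0 : 0 ≤ θ) (hθ1 : θ < 1) (hgs0 : ∀ j ≤ K, 0 < gs j) (hgs1 : ∀ j ≤ K, gs j ≤ 1) (hR0 : ∀ j ≤ K, 0 ≤ R j)
    (hR : ∀ j ≤ K, R j ≤ Dr * (Real.log ((gs j) ^ 2)⁻¹) ^ r) (hCW : 0 ≤ C_W) (hℓ : 0 ≤ ℓ) (hB : 0 ≤ B)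
    (hN : ∀ j ≤ K, (N j : ℝ) ≤ B * R j ^ 4)
    (ht : |t| * (C_W * ℓ * B * ((Dr * (1 / g ^ 2 + β') ^ r) ^ 4 * T4TubeBudget.geomPolyConst (4 * r) θ)) ≤ c) :
    T4UniformRadius.OscExponentBound C_W ℓ N θ K t c :=
  T4UniformRadius.oscExponentBound_of_discrete031 (discrete031_negSlope_of_defect h hb hD hpin) hβ' hDr hθ0 hθ1 hgs0
    hgs1 hR0 hR hCW hℓ hB hN ht

/-! ## §5 `T4GatedBooking`: the coupling constant `min(1/g², b)` becomes `min(1/(2g²), b)`, the radius constant is unchanged -/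

/-- `T4GatedBooking.sq_le_inv_of_discrete031` under the defected running (`D ≤ 1/(2g²)`): `g_j² ≤ (1/(2g²) + b(K−j))⁻¹`.
[cite: Balaban1987RG1, (0.31) p.259] -/
theorem sq_le_inv_of_defect {b β' D g : ℝ} {K : ℕ} {gs : ℕ → ℝ} (h : Defect b β' D K g gs) (hg : 0 < g)
    (hDg : D ≤ 1 / (2 * g ^ 2)) (hb : 0 ≤ b) {j : ℕ} (hj : j ≤ K) (hgs : 0 < gs j) :
    gs j ^ 2 ≤ (1 / (2 * g ^ 2) + b * (((K - j : ℕ) : ℝ)))⁻¹ := by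
  have hlow := h.lower_halfAnchor hDg hj
  have hcast : ((K : ℝ) - j) = (((K - j : ℕ) : ℝ)) := by rw [Nat.cast_sub hj]
  rw [hcast] at hlow
  have hDpos : 0 < 1 / (2 * g ^ 2) + b * (((K - j : ℕ) : ℝ)) := by positivity
  rw [one_div ((gs j) ^ 2)] at hlow
  exact (le_inv_comm₀ hDpos (pow_pos hgs 2)).mp hlow

/-- `T4GatedBooking.pow_coupling_le_of_discrete031` under the defected running: `g_j^{2p} ≤ (min(1/(2g²), b))^{−p}/((K−j)+1)^p`.
[folklore] -/
theorem pow_coupling_le_of_defect {b β' D g : ℝ} {K : ℕ} {gs : ℕ → ℝ} (h : Defect b β' D K g gs) (hg : 0 < g)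
    (hDg : D ≤ 1 / (2 * g ^ 2)) (hb : 0 < b) (p : ℕ) {j : ℕ} (hj : j ≤ K) (hgs : 0 < gs j) :
    gs j ^ (2 * p) ≤ ((min (1 / (2 * g ^ 2)) b)⁻¹) ^ p / ((((K - j : ℕ) : ℝ)) + 1) ^ p := by
  set n : ℕ := K - j with hn
  have hc : 0 < 1 / (2 * g ^ 2) := by positivity
  have hm : 0 < min (1 / (2 * g ^ 2)) b := lt_min hc hb
  have hn1 : 0 < ((n : ℝ)) + 1 := by positivity
  have hmn : 0 < min (1 / (2 * g ^ 2)) b * (((n : ℝ)) + 1) := mul_pos hm hn1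
  have hD' : min (1 / (2 * g ^ 2)) b * (((n : ℝ)) + 1) ≤ 1 / (2 * g ^ 2) + b * (n : ℝ) := min_mul_succ_le _ _ n
  have hsq : gs j ^ 2 ≤ (min (1 / (2 * g ^ 2)) b * (((n : ℝ)) + 1))⁻¹ :=
    (sq_le_inv_of_defect h hg hDg hb.le hj hgs).trans (inv_anti₀ hmn hD')
  calc gs j ^ (2 * p) = (gs j ^ 2) ^ p := pow_mul _ 2 p
    _ ≤ ((min (1 / (2 * g ^ 2)) b * (((n : ℝ)) + 1))⁻¹) ^ p := pow_le_pow_left₀ (sq_nonneg _) hsq p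
    _ = ((min (1 / (2 * g ^ 2)) b)⁻¹) ^ p / ((((n : ℝ)) + 1)) ^ p := by
        rw [mul_inv, mul_pow, inv_pow (((n : ℝ)) + 1),
          div_eq_mul_inv (((min (1 / (2 * g ^ 2)) b)⁻¹) ^ p) ((((n : ℝ)) + 1) ^ p)]

/-- `T4GatedBooking.weight_le_profile_of_discrete031` under the defected running (crude threshold `r·c + 2 ≤ p`; radius
amplitude `Dr`): `g_j^{2p} R_j^c ≤ weightProfile Cw (K−j)` with `Cw = (min(1/(2g²), b))^{−p} · (Dr(1/g²+β')^r)^c` — the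
coupling constant halved in the anchor, the radius constant VERBATIM. [folklore] -/
theorem weight_le_profile_of_defect {b β' D g Dr : ℝ} {K r p c : ℕ} {gs R : ℕ → ℝ} (h : Defect b β' D K g gs)
    (hD : 0 ≤ D) (hDg : D ≤ 1 / (2 * g ^ 2)) (hpin : gs K = g) (hb : 0 < b) (hβ' : 0 ≤ β') (hg : 0 < g)
    (hDr : 0 ≤ Dr) (hgs0 : ∀ j ≤ K, 0 < gs j) (hgs1 : ∀ j ≤ K, gs j ≤ 1) (hR0 : ∀ j ≤ K, 0 ≤ R j)
    (hR : ∀ j ≤ K, R j ≤ Dr * (Real.log ((gs j) ^ 2)⁻¹) ^ r) (hp : r * c + 2 ≤ p) {j : ℕ} (hj : j ≤ K) :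
    gs j ^ (2 * p) * R j ^ c
      ≤ weightProfile (((min (1 / (2 * g ^ 2)) b)⁻¹) ^ p * (Dr * (1 / g ^ 2 + β') ^ r) ^ c) (K - j) := by
  set n : ℕ := K - j with hn
  set A : ℝ := Dr * (1 / g ^ 2 + β') ^ r with hA
  set m : ℝ := (min (1 / (2 * g ^ 2)) b)⁻¹ with hm
  have hA0 : 0 ≤ A := mul_nonneg hDr (pow_nonneg (by positivity) r)
  have hm0 : 0 ≤ m := by
    have : 0 < min (1 / (2 * g ^ 2)) b := lt_min (by positivity) hb
    exact inv_nonneg.mpr this.le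
  have hx0 : (0 : ℝ) < (n : ℝ) + 1 := by positivity
  have hRj : R j ≤ A * (((n : ℝ)) + 1) ^ r := by
    have := radius_profile_of_defect h hb.le hD hpin hβ' hDr hgs0 hgs1 hR hj
    simpa [hA, hn] using this
  have hRc : R j ^ c ≤ A ^ c * (((n : ℝ)) + 1) ^ (r * c) := by
    calc R j ^ c ≤ (A * (((n : ℝ)) + 1) ^ r) ^ c := pow_le_pow_left₀ (hR0 j hj) hRj c
      _ = A ^ c * (((n : ℝ)) + 1) ^ (r * c) := by rw [mul_pow, ← pow_mul]
  have hgp : gs j ^ (2 * p) ≤ m ^ p / (((n : ℝ)) + 1) ^ p := by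
    have := pow_coupling_le_of_defect h hg hDg hb p hj (hgs0 j hj)
    simpa [hm, hn] using this
  have hprod : gs j ^ (2 * p) * R j ^ c ≤ (m ^ p / (((n : ℝ)) + 1) ^ p) * (A ^ c * (((n : ℝ)) + 1) ^ (r * c)) :=
    mul_le_mul hgp hRc (pow_nonneg (hR0 j hj) c) (div_nonneg (pow_nonneg hm0 p) (pow_nonneg hx0.le p))
  have hratio : (((n : ℝ)) + 1) ^ (r * c) / (((n : ℝ)) + 1) ^ p ≤ 1 / (((n : ℝ)) + 1) ^ 2 :=
    succ_pow_div_pow_le hp n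
  calc gs j ^ (2 * p) * R j ^ c
      ≤ (m ^ p / (((n : ℝ)) + 1) ^ p) * (A ^ c * (((n : ℝ)) + 1) ^ (r * c)) := hprod
    _ = (m ^ p * A ^ c) * ((((n : ℝ)) + 1) ^ (r * c) / (((n : ℝ)) + 1) ^ p) := by ring
    _ ≤ (m ^ p * A ^ c) * (1 / (((n : ℝ)) + 1) ^ 2) :=
        mul_le_mul_of_nonneg_left hratio (mul_nonneg (pow_nonneg hm0 p) (pow_nonneg hA0 c))
    _ = weightProfile (m ^ p * A ^ c) n := by rw [weightProfile, mul_one_div]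

/-- `T4GatedBooking.sum_weights_le_of_discrete031` under the defected running. [folklore] -/
theorem sum_weights_le_of_defect {b β' D g Dr : ℝ} {K r p c : ℕ} {gs R : ℕ → ℝ} (h : Defect b β' D K g gs)
    (hD : 0 ≤ D) (hDg : D ≤ 1 / (2 * g ^ 2)) (hpin : gs K = g) (hb : 0 < b) (hβ' : 0 ≤ β') (hg : 0 < g)
    (hDr : 0 ≤ Dr) (hgs0 : ∀ j ≤ K, 0 < gs j) (hgs1 : ∀ j ≤ K, gs j ≤ 1) (hR0 : ∀ j ≤ K, 0 ≤ R j)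
    (hR : ∀ j ≤ K, R j ≤ Dr * (Real.log ((gs j) ^ 2)⁻¹) ^ r) (hp : r * c + 2 ≤ p) :
    ∑ j ∈ range (K + 1), gs j ^ (2 * p) * R j ^ c
      ≤ ∑' n, weightProfile (((min (1 / (2 * g ^ 2)) b)⁻¹) ^ p * (Dr * (1 / g ^ 2 + β') ^ r) ^ c) n := by
  have hC : 0 ≤ ((min (1 / (2 * g ^ 2)) b)⁻¹) ^ p * (Dr * (1 / g ^ 2 + β') ^ r) ^ c := by
    have : 0 < min (1 / (2 * g ^ 2)) b := lt_min (by positivity) hb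
    exact mul_nonneg (pow_nonneg (inv_nonneg.mpr this.le) p)
      (pow_nonneg (mul_nonneg hDr (pow_nonneg (by positivity) r)) c)
  exact T4TubeBudget.sum_weights_le_tsum (w := fun j => gs j ^ (2 * p) * R j ^ c) (summable_weightProfile _)
    (weightProfile_nonneg hC)
    (fun j hj => weight_le_profile_of_defect h hD hDg hpin hb hβ' hg hDr hgs0 hgs1 hR0 hR hp hj)

/-- `T4GatedBooking.tubeBudget_uniform_of_discrete031` under the defected running: a `K`-indexed family, each run defected
with the SAME `b, β', D` and pinned at the SAME renormalised coupling `g` (`gs K K = g`); the SAME constant is a tube budget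
at every `K`. [folklore] -/
theorem tubeBudget_uniform_of_defect {b β' D g Dr A Λ τ : ℝ} {r p c : ℕ} {gs R : ℕ → ℕ → ℝ} {s : ℕ → ℕ → ℕ → ℝ}
    (h : ∀ K, Defect b β' D K g (gs K)) (hD : 0 ≤ D) (hDg : D ≤ 1 / (2 * g ^ 2)) (hpin : ∀ K, gs K K = g)
    (hb : 0 < b) (hβ' : 0 ≤ β') (hg : 0 < g) (hDr : 0 ≤ Dr) (hgs0 : ∀ K, ∀ j ≤ K, 0 < gs K j)
    (hgs1 : ∀ K, ∀ j ≤ K, gs K j ≤ 1) (hR0 : ∀ K, ∀ j ≤ K, 0 ≤ R K j)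
    (hR : ∀ K, ∀ j ≤ K, R K j ≤ Dr * (Real.log ((gs K j) ^ 2)⁻¹) ^ r) (hp : r * c + 2 ≤ p) (hA : 0 ≤ A)
    (hΛ : 0 ≤ Λ) (hτ0 : 0 ≤ τ) (hτ1 : τ ≤ 1) (hΛτ : Λ * τ ≤ 1)
    (hs : ∀ K, ∀ k ≤ K, ∀ j ≤ k, s K j k ≤ A * Λ ^ (k - j) * τ ^ (K - j)) :
    ∀ K, T4TubeBudget.TubeBudget K (fun j => gs K j ^ (2 * p) * R K j ^ c) (s K)
      (A * ∑' n, weightProfile (((min (1 / (2 * g ^ 2)) b)⁻¹) ^ p * (Dr * (1 / g ^ 2 + β') ^ r) ^ c) n) := by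
  have hC : 0 ≤ ((min (1 / (2 * g ^ 2)) b)⁻¹) ^ p * (Dr * (1 / g ^ 2 + β') ^ r) ^ c := by
    have : 0 < min (1 / (2 * g ^ 2)) b := lt_min (by positivity) hb
    exact mul_nonneg (pow_nonneg (inv_nonneg.mpr this.le) p)
      (pow_nonneg (mul_nonneg hDr (pow_nonneg (by positivity) r)) c)
  exact T4TubeBudget.tubeBudget_uniform (w := fun K j => gs K j ^ (2 * p) * R K j ^ c)
    (summable_weightProfile _) (weightProfile_nonneg hC)
    (fun K j hj => mul_nonneg (pow_nonneg (hgs0 K j hj).le _) (pow_nonneg (hR0 K j hj) _))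
    (fun K j hj => weight_le_profile_of_defect (h K) hD hDg (hpin K) hb hβ' hg hDr (hgs0 K) (hgs1 K) (hR0 K) (hR K)
      hp hj)
    hA hΛ hτ0 hτ1 hΛτ hs

/-- `T4GatedBooking.weight_le_sqrtProfile_of_discrete031` (SHARP threshold `p ≥ 2`; upper half and pin NOT used) under the
defected running: `g_j^{2p} R_j^c ≤ sqrtProfile Cw (K−j)` with
`Cw = (min(1/(2g²), b))^{−(p−1)} · √((min(1/(2g²), b))⁻¹) · (Dr^c · 2^{rc} · (rc)!)`. [folklore] -/
theorem weight_le_sqrtProfile_of_defect {b β' D g Dr : ℝ} {K r p c : ℕ} {gs R : ℕ → ℝ} (h : Defect b β' D K g gs)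
    (hDg : D ≤ 1 / (2 * g ^ 2)) (hb : 0 < b) (hg : 0 < g) (hDr : 0 ≤ Dr) (hgs0 : ∀ j ≤ K, 0 < gs j)
    (hgs1 : ∀ j ≤ K, gs j ≤ 1) (hR0 : ∀ j ≤ K, 0 ≤ R j) (hR : ∀ j ≤ K, R j ≤ Dr * (Real.log ((gs j) ^ 2)⁻¹) ^ r)
    (hp : 2 ≤ p) {j : ℕ} (hj : j ≤ K) :
    gs j ^ (2 * p) * R j ^ c
      ≤ sqrtProfile (((min (1 / (2 * g ^ 2)) b)⁻¹) ^ (p - 1) * Real.sqrt ((min (1 / (2 * g ^ 2)) b)⁻¹)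
          * (Dr ^ c * 2 ^ (r * c) * ((r * c).factorial : ℝ))) (K - j) := by
  set n : ℕ := K - j with hn
  set m : ℝ := (min (1 / (2 * g ^ 2)) b)⁻¹ with hm
  set E : ℝ := Dr ^ c * 2 ^ (r * c) * ((r * c).factorial : ℝ) with hE
  have hmin : 0 < min (1 / (2 * g ^ 2)) b := lt_min (by positivity) hb
  have hm0 : 0 ≤ m := inv_nonneg.mpr hmin.le
  have hx0 : (0 : ℝ) < (n : ℝ) + 1 := by positivity
  have hx1 : (1 : ℝ) ≤ (n : ℝ) + 1 := by
    have : (0 : ℝ) ≤ n := Nat.cast_nonneg n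
    linarith
  have hgj : 0 < gs j := hgs0 j hj
  have hsq : gs j ^ 2 ≤ m / (((n : ℝ)) + 1) := by
    have := pow_coupling_le_of_defect h hg hDg hb 1 hj hgj
    simpa [hm, hn] using this
  have hg1 : gs j ≤ Real.sqrt m / Real.sqrt (((n : ℝ)) + 1) := by
    calc gs j = Real.sqrt (gs j ^ 2) := (Real.sqrt_sq hgj.le).symm
      _ ≤ Real.sqrt (m / (((n : ℝ)) + 1)) := Real.sqrt_le_sqrt hsq
      _ = Real.sqrt m / Real.sqrt (((n : ℝ)) + 1) := Real.sqrt_div hm0 _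
  have hpm1 : 1 ≤ p - 1 := by omega
  have hsqp : (gs j ^ 2) ^ (p - 1) ≤ m ^ (p - 1) / (((n : ℝ)) + 1) := by
    calc (gs j ^ 2) ^ (p - 1) ≤ (m / (((n : ℝ)) + 1)) ^ (p - 1) := pow_le_pow_left₀ (sq_nonneg _) hsq _
      _ = m ^ (p - 1) / (((n : ℝ)) + 1) ^ (p - 1) := div_pow _ _ _
      _ ≤ m ^ (p - 1) / (((n : ℝ)) + 1) := by
          apply div_le_div_of_nonneg_left (pow_nonneg hm0 _) hx0
          calc (((n : ℝ)) + 1) = ((((n : ℝ)) + 1)) ^ 1 := (pow_one _).symm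
            _ ≤ ((((n : ℝ)) + 1)) ^ (p - 1) := pow_le_pow_right₀ hx1 hpm1
  have hRc : R j ^ c ≤ Dr ^ c * (Real.log ((gs j) ^ 2)⁻¹) ^ (r * c) := by
    calc R j ^ c ≤ (Dr * (Real.log ((gs j) ^ 2)⁻¹) ^ r) ^ c := pow_le_pow_left₀ (hR0 j hj) (hR j hj) c
      _ = Dr ^ c * (Real.log ((gs j) ^ 2)⁻¹) ^ (r * c) := by rw [mul_pow, ← pow_mul]
  have hgR : gs j * R j ^ c ≤ E := by
    calc gs j * R j ^ c ≤ gs j * (Dr ^ c * (Real.log ((gs j) ^ 2)⁻¹) ^ (r * c)) :=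
          mul_le_mul_of_nonneg_left hRc hgj.le
      _ = Dr ^ c * (gs j * (Real.log ((gs j) ^ 2)⁻¹) ^ (r * c)) := by ring
      _ ≤ Dr ^ c * (2 ^ (r * c) * ((r * c).factorial : ℝ)) :=
          mul_le_mul_of_nonneg_left (mul_pow_log_inv_sq_le hgj (hgs1 j hj) (r * c)) (pow_nonneg hDr c)
      _ = E := by rw [hE]; ring
  have hsplit : gs j ^ (2 * p) * R j ^ c = (gs j ^ 2) ^ (p - 1) * gs j * (gs j * R j ^ c) := by
    have h2p : 2 * p = 2 * (p - 1) + 1 + 1 := by omega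
    rw [h2p, pow_succ, pow_succ, pow_mul]
    ring
  rw [hsplit]
  have hA0 : 0 ≤ m ^ (p - 1) / (((n : ℝ)) + 1) := div_nonneg (pow_nonneg hm0 _) hx0.le
  have hB0 : 0 ≤ Real.sqrt m / Real.sqrt (((n : ℝ)) + 1) := div_nonneg (Real.sqrt_nonneg _) (Real.sqrt_nonneg _)
  calc (gs j ^ 2) ^ (p - 1) * gs j * (gs j * R j ^ c)
      ≤ (m ^ (p - 1) / (((n : ℝ)) + 1)) * (Real.sqrt m / Real.sqrt (((n : ℝ)) + 1)) * E :=
        mul_le_mul (mul_le_mul hsqp hg1 hgj.le hA0) hgR (mul_nonneg hgj.le (pow_nonneg (hR0 j hj) c))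
          (mul_nonneg hA0 hB0)
    _ = sqrtProfile (m ^ (p - 1) * Real.sqrt m * E) n := by
        rw [sqrtProfile, div_mul_div_comm, div_mul_eq_mul_div]

/-- `T4GatedBooking.sum_weights_le_of_discrete031_sharp` under the defected running. [folklore] -/
theorem sum_weights_le_of_defect_sharp {b β' D g Dr : ℝ} {K r p c : ℕ} {gs R : ℕ → ℝ} (h : Defect b β' D K g gs)
    (hDg : D ≤ 1 / (2 * g ^ 2)) (hb : 0 < b) (hg : 0 < g) (hDr : 0 ≤ Dr) (hgs0 : ∀ j ≤ K, 0 < gs j)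
    (hgs1 : ∀ j ≤ K, gs j ≤ 1) (hR0 : ∀ j ≤ K, 0 ≤ R j) (hR : ∀ j ≤ K, R j ≤ Dr * (Real.log ((gs j) ^ 2)⁻¹) ^ r)
    (hp : 2 ≤ p) :
    ∑ j ∈ range (K + 1), gs j ^ (2 * p) * R j ^ c
      ≤ ∑' n, sqrtProfile (((min (1 / (2 * g ^ 2)) b)⁻¹) ^ (p - 1) * Real.sqrt ((min (1 / (2 * g ^ 2)) b)⁻¹)
          * (Dr ^ c * 2 ^ (r * c) * ((r * c).factorial : ℝ))) n := by
  have hC : 0 ≤ ((min (1 / (2 * g ^ 2)) b)⁻¹) ^ (p - 1) * Real.sqrt ((min (1 / (2 * g ^ 2)) b)⁻¹)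
      * (Dr ^ c * 2 ^ (r * c) * ((r * c).factorial : ℝ)) := by
    have : 0 < min (1 / (2 * g ^ 2)) b := lt_min (by positivity) hb
    exact mul_nonneg (mul_nonneg (pow_nonneg (inv_nonneg.mpr this.le) _) (Real.sqrt_nonneg _))
      (mul_nonneg (mul_nonneg (pow_nonneg hDr c) (pow_nonneg (by norm_num) _)) (Nat.cast_nonneg _))
  exact T4TubeBudget.sum_weights_le_tsum (w := fun j => gs j ^ (2 * p) * R j ^ c) (summable_sqrtProfile _)
    (sqrtProfile_nonneg hC)
    (fun j hj => weight_le_sqrtProfile_of_defect h hDg hb hg hDr hgs0 hgs1 hR0 hR hp hj)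

/-- `T4GatedBooking.tubeBudget_uniform_of_discrete031_sharp` under the defected running (`K`-indexed family with the SAME
`b, D` and final coupling `g`; no pin needed). [folklore] -/
theorem tubeBudget_uniform_of_defect_sharp {b β' D g Dr A Λ τ : ℝ} {r p c : ℕ} {gs R : ℕ → ℕ → ℝ}
    {s : ℕ → ℕ → ℕ → ℝ} (h : ∀ K, Defect b β' D K g (gs K)) (hDg : D ≤ 1 / (2 * g ^ 2)) (hb : 0 < b)
    (hg : 0 < g) (hDr : 0 ≤ Dr) (hgs0 : ∀ K, ∀ j ≤ K, 0 < gs K j) (hgs1 : ∀ K, ∀ j ≤ K, gs K j ≤ 1)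
    (hR0 : ∀ K, ∀ j ≤ K, 0 ≤ R K j) (hR : ∀ K, ∀ j ≤ K, R K j ≤ Dr * (Real.log ((gs K j) ^ 2)⁻¹) ^ r)
    (hp : 2 ≤ p) (hA : 0 ≤ A) (hΛ : 0 ≤ Λ) (hτ0 : 0 ≤ τ) (hτ1 : τ ≤ 1) (hΛτ : Λ * τ ≤ 1)
    (hs : ∀ K, ∀ k ≤ K, ∀ j ≤ k, s K j k ≤ A * Λ ^ (k - j) * τ ^ (K - j)) :
    ∀ K, T4TubeBudget.TubeBudget K (fun j => gs K j ^ (2 * p) * R K j ^ c) (s K)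
      (A * ∑' n, sqrtProfile (((min (1 / (2 * g ^ 2)) b)⁻¹) ^ (p - 1) * Real.sqrt ((min (1 / (2 * g ^ 2)) b)⁻¹)
          * (Dr ^ c * 2 ^ (r * c) * ((r * c).factorial : ℝ))) n) := by
  have hC : 0 ≤ ((min (1 / (2 * g ^ 2)) b)⁻¹) ^ (p - 1) * Real.sqrt ((min (1 / (2 * g ^ 2)) b)⁻¹)
      * (Dr ^ c * 2 ^ (r * c) * ((r * c).factorial : ℝ)) := by
    have : 0 < min (1 / (2 * g ^ 2)) b := lt_min (by positivity) hb
    exact mul_nonneg (mul_nonneg (pow_nonneg (inv_nonneg.mpr this.le) _) (Real.sqrt_nonneg _))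
      (mul_nonneg (mul_nonneg (pow_nonneg hDr c) (pow_nonneg (by norm_num) _)) (Nat.cast_nonneg _))
  exact T4TubeBudget.tubeBudget_uniform (w := fun K j => gs K j ^ (2 * p) * R K j ^ c)
    (summable_sqrtProfile _) (sqrtProfile_nonneg hC)
    (fun K j hj => mul_nonneg (pow_nonneg (hgs0 K j hj).le _) (pow_nonneg (hR0 K j hj) _))
    (fun K j hj => weight_le_sqrtProfile_of_defect (h K) hDg hb hg hDr (hgs0 K) (hgs1 K) (hR0 K) (hR K) hp hj)
    hA hΛ hτ0 hτ1 hΛτ hs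

/-! ## §6 `T4BookingNecessity`: the smallness clause `g ≤ 1` becomes `2g² ≤ 1`, the upper half is verbatim -/

/-- `T4BookingNecessity.one_le_inv_sq` under the defected running: with `b ≥ 0`, `D ≤ 1/(2g²)` and the strengthened
smallness `2g² ≤ 1` (in place of `g ≤ 1`), every coupling on the trajectory is at most one: `1 ≤ 1/g_j²`. [folklore] -/
theorem one_le_inv_sq_of_defect {b β' D g : ℝ} {K : ℕ} {gs : ℕ → ℝ} (hb : 0 ≤ b) (hg : 0 < g) (hg2 : 2 * g ^ 2 ≤ 1)
    (hDg : D ≤ 1 / (2 * g ^ 2)) (h : Defect b β' D K g gs) {j : ℕ} (hj : j ≤ K) : 1 ≤ 1 / gs j ^ 2 := by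
  have h1 : (1 : ℝ) ≤ 1 / (2 * g ^ 2) := by
    rw [le_div_iff₀ (by positivity), one_mul]
    exact hg2
  have h2 : 0 ≤ b * ((K : ℝ) - j) := mul_nonneg hb (sub_nonneg.2 (by exact_mod_cast hj))
  linarith [h.lower_halfAnchor hDg hj]

/-- `T4BookingNecessity.inv_sq_le_logWindow` under the defected running: verbatim (upper half only, no pin needed).
[folklore] -/
theorem inv_sq_le_logWindow_of_defect {b β' D g C : ℝ} {K : ℕ} {gs : ℕ → ℝ} (hβ : 0 ≤ β') (hC : 0 ≤ C)
    (h : Defect b β' D K g gs) {j : ℕ} (hj1 : T4GoodClassBudget.jlogOf C K ≤ j) (hj2 : j ≤ K) :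
    1 / gs j ^ 2 ≤ 1 / g ^ 2 + β' * (C * Real.log ((K : ℝ) + 1) + 1) := by
  have h1 : (K : ℝ) - j ≤ C * Real.log ((K : ℝ) + 1) + 1 := by
    have e : (K : ℝ) - j = ((K - j : ℕ) : ℝ) := (Nat.cast_sub hj2).symm
    have h2 : ((K - j : ℕ) : ℝ) ≤ ((K - T4GoodClassBudget.jlogOf C K : ℕ) : ℝ) := by
      exact_mod_cast (by omega : K - j ≤ K - T4GoodClassBudget.jlogOf C K)
    rw [e]
    exact h2.trans (T4GoodClassBudget.sub_jlogOf_le hC K)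
  exact (h j hj2).2.trans (by linarith [mul_le_mul_of_nonneg_left h1 hβ])

/-- `T4BookingNecessity.eventually_inv_sq_le_mul_log` under the defected running (one `Defect` per number of steps `K`,
the SAME `b, β', D` and renormalised coupling `g` with `2g² ≤ 1`, `D ≤ 1/(2g²)`): eventually in `K` and on the whole log
window, `1 ≤ 1/g_j² ≤ (1/g² + β'(C+1))·log(K+1)` — verbatim conclusion; the three `eventually_rpow_neg_le_…` theorems of
that module consume `h031` only through this one. [folklore] -/
theorem eventually_inv_sq_le_mul_log_of_defect {b β' D g C : ℝ} {gs : ℕ → ℕ → ℝ} (hb : 0 ≤ b) (hβ : 0 ≤ β')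
    (hg : 0 < g) (hg2 : 2 * g ^ 2 ≤ 1) (hDg : D ≤ 1 / (2 * g ^ 2)) (hC : 0 ≤ C)
    (hdef : ∀ K, Defect b β' D K g (gs K)) :
    ∀ᶠ K : ℕ in atTop, ∀ j, T4GoodClassBudget.jlogOf C K ≤ j → j ≤ K →
      1 ≤ 1 / gs K j ^ 2 ∧ 1 / gs K j ^ 2 ≤ (1 / g ^ 2 + β' * (C + 1)) * Real.log ((K : ℝ) + 1) := by
  filter_upwards [T4BookingNecessity.tendsto_log_succ_atTop.eventually (eventually_ge_atTop (1 : ℝ))]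
    with K hK j hj1 hj2
  refine ⟨one_le_inv_sq_of_defect hb hg hg2 hDg (hdef K) hj2,
    (inv_sq_le_logWindow_of_defect hβ hC (hdef K) hj1 hj2).trans ?_⟩
  have h1 : 1 / g ^ 2 ≤ 1 / g ^ 2 * Real.log ((K : ℝ) + 1) := le_mul_of_one_le_right (by positivity) hK
  have h2 : β' * (C * Real.log ((K : ℝ) + 1) + 1) ≤
      β' * (C * Real.log ((K : ℝ) + 1) + Real.log ((K : ℝ) + 1)) :=
    mul_le_mul_of_nonneg_left (by linarith) hβ
  have e : (1 / g ^ 2 + β' * (C + 1)) * Real.log ((K : ℝ) + 1) =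
      1 / g ^ 2 * Real.log ((K : ℝ) + 1) + β' * (C * Real.log ((K : ℝ) + 1) + Real.log ((K : ℝ) + 1)) := by ring
  rw [e]
  linarith

/-! ## §7 `T4SyncThresholds`: two-sided comparability survives with `c₀² = β'/b + 1` -/

/-- Core arithmetic of `T4SyncThresholds.sq_cross_bound` with a defected lower anchor: `a − D + b t ≤ 1/x²`,
`1/y² ≤ a + β t`, `0 ≤ 2D ≤ a`, `0 < b ≤ β`, `t ≥ 0`, `x, y > 0` give `b x² ≤ (β + b) y²`. [folklore] -/
theorem sq_cross_bound_defect {x y a D t b β : ℝ} (hx : 0 < x) (hy : 0 < y) (hD0 : 0 ≤ D) (hDa : 2 * D ≤ a)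
    (hb : 0 < b) (hbβ : b ≤ β) (ht : 0 ≤ t) (hlo : a - D + b * t ≤ 1 / x ^ 2) (hhi : 1 / y ^ 2 ≤ a + β * t) :
    b * x ^ 2 ≤ (β + b) * y ^ 2 := by
  have hβ0 : 0 ≤ β := le_trans hb.le hbβ
  have ha : 0 ≤ a := by linarith
  have k1 : (β + b) * (a / 2) ≤ (β + b) * (a - D) := mul_le_mul_of_nonneg_left (by linarith) (by linarith)
  have k2 : b * a ≤ (β + b) * (a / 2) := by
    have : 0 ≤ (β - b) * a := mul_nonneg (by linarith) ha
    linarith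
  have k3 : 0 ≤ b * b * t := by positivity
  have lhs : b * (1 / y ^ 2) ≤ b * a + b * (β * t) := by
    have := mul_le_mul_of_nonneg_left hhi hb.le
    linarith [mul_add b a (β * t)]
  have rhs : (β + b) * (a - D + b * t) ≤ (β + b) * (1 / x ^ 2) := mul_le_mul_of_nonneg_left hlo (by linarith)
  have key : b * a + b * (β * t) ≤ (β + b) * (a - D + b * t) := by
    have e1 : (β + b) * (a - D + b * t) = (β + b) * (a - D) + β * (b * t) + b * b * t := by ring
    have e2 : b * (β * t) = β * (b * t) := by ring
    linarith
  have h1 : b * (1 / y ^ 2) ≤ (β + b) * (1 / x ^ 2) := by linarith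
  have h2 : b * (1 / y ^ 2) * (x ^ 2 * y ^ 2) ≤ (β + b) * (1 / x ^ 2) * (x ^ 2 * y ^ 2) :=
    mul_le_mul_of_nonneg_right h1 (by positivity)
  have hx2 : 0 < x ^ 2 := by positivity
  have hy2 : 0 < y ^ 2 := by positivity
  have e1 : b * (1 / y ^ 2) * (x ^ 2 * y ^ 2) = b * x ^ 2 := by field_simp
  have e2 : (β + b) * (1 / x ^ 2) * (x ^ 2 * y ^ 2) = (β + b) * y ^ 2 := by field_simp
  linarith [h2, e1, e2]

/-- **Synchronisation comparability under the defected running** (`T4SyncThresholds.sync_sq_ratio` re-keyed): the realised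
couplings of a defected run (`0 ≤ D ≤ 1/(2g²)`) and a reference sequence with the literal sandwich `RefSandwich b β' g ḡ`
are two-sidedly comparable at equal physical scale: `b·g_k² ≤ (β' + b)·ḡ_{K−k}²` (constant `β'/b + 1` in place of the
literal `β'/b`) and, verbatim, `b·ḡ_{K−k}² ≤ β'·g_k²`.  The module's `sync_log_le`, `sync_profile_le`, `sync_eps_sq_le`,
`sync_R_le` are derived from `sync_sq_ratio` by arithmetic in which only `log(β'/b) ↦ log(β'/b + 1)` changes.
[cite: Balaban1987RG1, (0.31) p.259] -/
theorem sync_sq_ratio_of_defect {K : ℕ} {gs gbar : ℕ → ℝ} {b β' D g : ℝ} (h : Defect b β' D K g gs) (hD0 : 0 ≤ D)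
    (hDg : D ≤ 1 / (2 * g ^ 2)) (href : T4SyncThresholds.RefSandwich b β' g gbar) (hb : 0 < b) (hbβ : b ≤ β')
    (hg : 0 < g) (hpos : ∀ k, k ≤ K → 0 < gs k) (hbar : ∀ n, 0 < gbar n) {k : ℕ} (hk : k ≤ K) :
    b * (gs k) ^ 2 ≤ (β' + b) * (gbar (K - k)) ^ 2 ∧ b * (gbar (K - k)) ^ 2 ≤ β' * (gs k) ^ 2 := by
  have hrun := h k hk
  have hre := href (K - k)
  have hcast : ((K - k : ℕ) : ℝ) = (K : ℝ) - k := Nat.cast_sub hk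
  rw [hcast] at hre
  have ha : 0 ≤ 1 / g ^ 2 := by positivity
  have ht : 0 ≤ (K : ℝ) - k := sub_nonneg.2 (by exact_mod_cast hk)
  have hDa : 2 * D ≤ 1 / g ^ 2 := by
    have e : (1 : ℝ) / (2 * g ^ 2) = 1 / g ^ 2 / 2 := by ring
    rw [e] at hDg
    linarith
  exact ⟨sq_cross_bound_defect (hpos k hk) (hbar (K - k)) hD0 hDa hb hbβ ht hrun.1 hre.2,
    T4SyncThresholds.sq_cross_bound (hbar (K - k)) (hpos k hk) ha hb hbβ hre.1 hrun.2⟩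

end Literature.MathematicalPhysics.QuantumFieldTheory.Balaban1983to89.T4Discrete031Defect
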